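import Summits.BirchSwinnertonDyer.BirchSwinnertonDyer.Theorems.EisensteinPrimesBSDpOnCellCAccumHelpersTwo
import HarnessLib

/-!
# `p`-adic accumulation of rational divisibilities along a convergent sequence of fibres — part 3: Theorem U₂ `dvd_limit_of_uniform_members` / `uniform_variant_holds`; content decomposition; Theorem P `dvd_limit_of_members` (varying constants)
# (cell `bsd-eis`, crux 4 `BSDpOnCellC` stmt-BirchSwinnertonDyer-19034, line «accum» — the ACCUMULATION LEVER behind the registered stub
# `stub_twoVarRatDivPNew` (crystal v7+); mathematics and Lean text by ideator bsd-idea-12 g15, `HOME pub/ideators/bsd-idea-12/bc/AccumHelpers.lean`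
# sha16 d22ccc6e94281a99 = §0a of `Cruxes/BSDpOnCellC/Lines/accum.lean` v1.5, sorry-free, Mathlib-only; critic idea-crit-14 V99 N2 asked for it to be
# landed as a built module; landed VERBATIM (split into 4 files ≤ 400 l.; part 3/4) by the LEAD cruxlead-19034 g0, `--supports -19034`)

HONEST FRAMING: pure commutative algebra over Mathlib (power series over a complete DVR; Weierstrass division by `X − x`; `π`-adic limits); standard
axioms, no `sorry`, no instance, no notation; nothing about any curve, Selmer group or `L`-function is asserted. It is the INTENDED PROOF MACHINERY of
the stub (member-wise rational divisibilities at the good crystalline members of a Hida branch ACCUMULATE `p`-adically to the `p`-new fibre), not a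
proof of the stub: the member inputs and the fibre control remain. Contents of the whole module (source docstring):

# `p`-adic accumulation of rational divisibilities along a convergent sequence of fibres
(helper module candidate; pure commutative algebra over Mathlib; standard axioms; no `sorry`)

Source: ideator `bsd-idea-12` g15, line «accum» on crux `BSDpOnCellC` (stmt-BirchSwinnertonDyer-19034), where §0a of
`Summits/BirchSwinnertonDyer/BirchSwinnertonDyer/Cruxes/BSDpOnCellC/Lines/accum.lean` (v1.5) carries the same declarations
inside the crux namespace. Critic idea-crit-14 VERDICT #99 N2 asked that this algebra be landed as a built helper module by a
prover/LEAD (`ledger propose … --supports stmt-BirchSwinnertonDyer-19034 --as helper`); this file is the ready source.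

SETTING. `𝒪` a complete DVR (in the application `ℤ_p`), `R := 𝒪⟦X⟧⟦T₂⟧⟦T₁⟧` (as `PowerSeries (PowerSeries (PowerSeries 𝒪))`,
innermost variable `X`), fibre ring `S := 𝒪⟦T₂⟧⟦T₁⟧`, `[X − y] := C (C (X − C y))`.

CONTENTS.
* `co`, `co_C_C_mul`, `eq_zero_of_co_eq_zero` — double coefficients.
* Theorem A `exists_eq_C_C_pow_mul_unit_of_coeff_adic_limit` — closedness of `π^ℕ·(units)` in `S` under coefficientwise
  `π`-adic convergence uniform in the index; `finite_pow_dvd_of_dvr`.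
* Evaluation calculus `evAt` / `EvAt` at a point of the maximal ideal = Weierstrass division by the degree-one distinguished
  polynomial `X − x` (`Polynomial.IsDistinguishedAt.algEquivQuotient`, `Polynomial.quotientSpanXSubCAlgEquiv`): `evAt_C`,
  `evAt_X`, `evAt_eq_zero_iff` (kernel `= (X − C x)`), `sub_dvd_evAt_sub_evAt`, `EvAt_C_C`, `co_EvAt`,
  `C_C_dvd_of_EvAt_eq_zero`, `EvAt_lift`.
* Theorem U₁ `not_dvd_of_uniform_members` — uniform member constant and `[X − x_∞] ∤ L` ⟹ `[X − x_∞] ∤ F`.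
* Solving lemma `exists_mul_eq_of_forall_exists_mod` — `A·Z ≡ B (mod π^m)` solvable in `S` for all `m` ⟹ `A·Z = B` solvable
  (content decomposition; a unit-content series is a non-zero-divisor modulo every `π^m` because `(𝒪/π)⟦T₂⟧⟦T₁⟧` is a domain —
  `C_C_dvd_of_dvd_mul`, `C_C_pow_dvd_of_dvd_mul`; Cauchy + `IsPrecomplete`).
* Theorem U₂ `dvd_limit_of_uniform_members`, `uniform_variant_holds` — the uniform-constant accumulation lemma.
* Content decomposition `exists_eq_C_C_pow_mul_not_dvd`; Theorem P `dvd_limit_of_members` — the accumulation lemma with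
  VARYING member constants: `∀ k, p^{c_k}·L ∈ (F, [X − x_k])`, `x_k → x_∞` `p`-adically, `[X − x_∞] ∤ F` ⟹
  `∃ a, p^a·L ∈ (F, [X − x_∞])` (no unique factorisation used).
* Consumer schema `C_C_pow_mul_limit_mem_of_members` / `C_C_pow_mul_limit_mem_of_uniform_members` — an ideal `I ∋ p^m·F(x_∞)`
  receives `p^{c'}·L(x_∞)`.

[cite: BuyukbodukLei2020, App. A Prop. 25 (arXiv:2008.08411 p. 51: the exact, Zariski-infinite, uniform-constant, upward sibling
«a divisibility criterion in regular rings»)]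
-/

set_option autoImplicit false
set_option linter.dupNamespace false

noncomputable section

namespace Summit.BirchSwinnertonDyer.BirchSwinnertonDyer.Theorems.AccumHelpers

open PowerSeries

/-! ### Theorem U₂: with a UNIFORM member constant the limit-fibre divisibility holds outright
(no UFD, no nondegeneracy) — hence `AccumulationLemma₂U` is a THEOREM. -/

section Uniform2

open Filter

/-- the constant lift `𝒪⟦T₂⟧⟦T₁⟧ → 𝒪⟦X⟧⟦T₂⟧⟦T₁⟧` is a section of every `EvAt`. -/
lemma EvAt_lift {𝒪 : Type*} [CommRing 𝒪] [IsLocalRing 𝒪]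
    [IsAdicComplete (IsLocalRing.maximalIdeal 𝒪) 𝒪] (x : 𝒪) (hx : x ∈ IsLocalRing.maximalIdeal 𝒪)
    (Z : PowerSeries (PowerSeries 𝒪)) :
    EvAt x hx (PowerSeries.map (PowerSeries.map (PowerSeries.C (R := 𝒪))) Z) = Z := by
  apply eq_of_sub_eq_zero
  apply eq_zero_of_co_eq_zero
  intro i j
  rw [co, map_sub, map_sub, ← co, co_EvAt, PowerSeries.coeff_map, PowerSeries.coeff_map, evAt_C]
  simp

/-- Helper `dvd_limit_of_uniform_members` of the accumulation lemma (line «accum» §0a; statement as displayed; pure commutative algebra). [folklore] -/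
theorem dvd_limit_of_uniform_members {p : ℕ} [Fact p.Prime]
    (𝒪 : Type*) [CommRing 𝒪] [IsDomain 𝒪] [IsDiscreteValuationRing 𝒪] [Algebra ℤ_[p] 𝒪]
    [IsAdicComplete (IsLocalRing.maximalIdeal 𝒪) 𝒪] (hp : Irreducible ((p : ℕ) : 𝒪))
    (F L : PowerSeries (PowerSeries (PowerSeries 𝒪))) (x : ℕ → ℤ_[p]) (xlim : ℤ_[p]) (c : ℕ)
    (hxk : ∀ k, ‖x k‖ < 1) (hxlim : ‖xlim‖ < 1)
    (hconv : Tendsto x atTop (nhds xlim))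
    (hmem : ∀ k, ∃ G U : PowerSeries (PowerSeries (PowerSeries 𝒪)),
      PowerSeries.C (PowerSeries.C (PowerSeries.C (((p : ℕ) : 𝒪) ^ c))) * L =
        F * G + PowerSeries.C (PowerSeries.C (PowerSeries.X - PowerSeries.C (algebraMap ℤ_[p] 𝒪 (x k)))) * U) :
    ∃ (G U : PowerSeries (PowerSeries (PowerSeries 𝒪))),
      PowerSeries.C (PowerSeries.C (PowerSeries.C (((p : ℕ) : 𝒪) ^ c))) * L =
        F * G + PowerSeries.C (PowerSeries.C (PowerSeries.X - PowerSeries.C (algebraMap ℤ_[p] 𝒪 xlim))) * U := by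
  classical
  have hpmem : ((p : ℕ) : 𝒪) ∈ IsLocalRing.maximalIdeal 𝒪 :=
    (IsLocalRing.mem_maximalIdeal _).mpr hp.not_isUnit
  have hpt : ∀ z : ℤ_[p], ‖z‖ < 1 → algebraMap ℤ_[p] 𝒪 z ∈ IsLocalRing.maximalIdeal 𝒪 := by
    intro z hz
    obtain ⟨y, hy⟩ := (PadicInt.norm_lt_one_iff_dvd z).mp hz
    rw [hy, map_mul, map_natCast]
    exact Ideal.mul_mem_right _ _ hpmem
  set xs : ℕ → 𝒪 := fun k => algebraMap ℤ_[p] 𝒪 (x k) with hxs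
  set xsl : 𝒪 := algebraMap ℤ_[p] 𝒪 xlim with hxsl
  have hxs_mem : ∀ k, xs k ∈ IsLocalRing.maximalIdeal 𝒪 := fun k => hpt _ (hxk k)
  have hxsl_mem : xsl ∈ IsLocalRing.maximalIdeal 𝒪 := hpt _ hxlim
  have hdiff : ∀ m : ℕ, ∀ᶠ k in atTop, ((p : ℕ) : 𝒪) ^ m ∣ xs k - xsl := by
    intro m
    filter_upwards [eventually_pow_dvd_sub x xlim hconv m] with k hk
    have := map_dvd (algebraMap ℤ_[p] 𝒪) hk
    simpa [map_pow, map_natCast, map_sub] using this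
  -- fibres: notation
  set Finf := EvAt xsl hxsl_mem F with hFinf
  set Linf := EvAt xsl hxsl_mem L with hLinf
  -- uniform convergence of fibres: `C(C(p^m)) ∣ Ev_k H - Ev_∞ H` once `p^m ∣ xs k - xsl`
  have hfib : ∀ (m k : ℕ), ((p : ℕ) : 𝒪) ^ m ∣ xs k - xsl →
      ∀ H : PowerSeries (PowerSeries (PowerSeries 𝒪)),
        PowerSeries.C (PowerSeries.C (((p : ℕ) : 𝒪) ^ m)) ∣
          EvAt (xs k) (hxs_mem k) H - EvAt xsl hxsl_mem H := by
    intro m k hk H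
    rw [C_C_dvd_iff_forall_co_dvd]
    intro i j
    rw [co, map_sub, map_sub, ← co, ← co, co_EvAt, co_EvAt]
    exact hk.trans (sub_dvd_evAt_sub_evAt _ _ (hxs_mem k) hxsl_mem _)
  -- solvability of `Finf · Z = p^c · Linf` modulo every `p^m`
  have hsol : ∀ m : ℕ, ∃ Z : PowerSeries (PowerSeries 𝒪),
      PowerSeries.C (PowerSeries.C (((p : ℕ) : 𝒪) ^ m)) ∣
        Finf * Z - PowerSeries.C (PowerSeries.C (((p : ℕ) : 𝒪) ^ c)) * Linf := by
    intro m
    obtain ⟨k, hk⟩ := (hdiff m).exists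
    obtain ⟨G, U, hGU⟩ := hmem k
    have e1 : EvAt (xs k) (hxs_mem k) (PowerSeries.C (PowerSeries.C (PowerSeries.C (((p : ℕ) : 𝒪) ^ c)))) =
        PowerSeries.C (PowerSeries.C (((p : ℕ) : 𝒪) ^ c)) := by
      rw [EvAt_C_C, evAt_C]
    have e3 : EvAt (xs k) (hxs_mem k)
        (PowerSeries.C (PowerSeries.C (PowerSeries.X - PowerSeries.C (algebraMap ℤ_[p] 𝒪 (x k))))) = 0 := by
      rw [EvAt_C_C, map_sub, evAt_X, evAt_C,
        show xs k - algebraMap ℤ_[p] 𝒪 (x k) = 0 from sub_self _, map_zero, map_zero]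
    have hEv := congrArg (EvAt (xs k) (hxs_mem k)) hGU
    simp only [map_mul, map_add, e1, e3, zero_mul, add_zero] at hEv
    -- hEv : C(C(p^c)) * Ev_k L = Ev_k F * Ev_k G
    refine ⟨EvAt (xs k) (hxs_mem k) G, ?_⟩
    have hF := hfib m k hk F
    have hL := hfib m k hk L
    have key : Finf * EvAt (xs k) (hxs_mem k) G -
        PowerSeries.C (PowerSeries.C (((p : ℕ) : 𝒪) ^ c)) * Linf =
        -((EvAt (xs k) (hxs_mem k) F - Finf) * EvAt (xs k) (hxs_mem k) G) +
          PowerSeries.C (PowerSeries.C (((p : ℕ) : 𝒪) ^ c)) * (EvAt (xs k) (hxs_mem k) L - Linf) := by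
      rw [mul_sub, hEv]; ring
    rw [key]
    exact dvd_add (dvd_neg.mpr (dvd_mul_of_dvd_left hF _)) (dvd_mul_of_dvd_right hL _)
  obtain ⟨Z, hZ⟩ := exists_mul_eq_of_forall_exists_mod ((p : ℕ) : 𝒪) hp Finf _ hsol
  -- lift Z to the three-variable ring and read off the remainder
  set G := PowerSeries.map (PowerSeries.map (PowerSeries.C (R := 𝒪))) Z with hG
  have hEvG : EvAt xsl hxsl_mem G = Z := EvAt_lift xsl hxsl_mem Z
  have hrem : EvAt xsl hxsl_mem
      (PowerSeries.C (PowerSeries.C (PowerSeries.C (((p : ℕ) : 𝒪) ^ c))) * L - F * G) = 0 := by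
    rw [map_sub, map_mul, map_mul, EvAt_C_C, evAt_C, hEvG, ← hFinf, ← hLinf, hZ, sub_self]
  obtain ⟨U, hU⟩ := C_C_dvd_of_EvAt_eq_zero xsl hxsl_mem _ hrem
  exact ⟨G, U, by rw [← hU]; ring⟩

/-- **`AccumulationLemma₂U` is a theorem** (both conjuncts): U₁ gives the nondegeneracy, U₂ the divisibility. -/
theorem uniform_variant_holds {p : ℕ} [Fact p.Prime]
    (𝒪 : Type*) [CommRing 𝒪] [IsDomain 𝒪] [IsDiscreteValuationRing 𝒪] [Algebra ℤ_[p] 𝒪]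
    [IsAdicComplete (IsLocalRing.maximalIdeal 𝒪) 𝒪] (hp : Irreducible ((p : ℕ) : 𝒪))
    (F L : PowerSeries (PowerSeries (PowerSeries 𝒪))) (x : ℕ → ℤ_[p]) (xlim : ℤ_[p]) (c : ℕ)
    (hxk : ∀ k, ‖x k‖ < 1) (hxlim : ‖xlim‖ < 1)
    (hconv : Tendsto x atTop (nhds xlim))
    (hmem : ∀ k, ∃ G U : PowerSeries (PowerSeries (PowerSeries 𝒪)),
      PowerSeries.C (PowerSeries.C (PowerSeries.C (((p : ℕ) : 𝒪) ^ c))) * L =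
        F * G + PowerSeries.C (PowerSeries.C (PowerSeries.X - PowerSeries.C (algebraMap ℤ_[p] 𝒪 (x k)))) * U)
    (hL : ¬ (PowerSeries.C (PowerSeries.C (PowerSeries.X - PowerSeries.C (algebraMap ℤ_[p] 𝒪 xlim))) ∣ L)) :
    ¬ (PowerSeries.C (PowerSeries.C (PowerSeries.X - PowerSeries.C (algebraMap ℤ_[p] 𝒪 xlim))) ∣ F) ∧
    ∃ (a : ℕ) (G U : PowerSeries (PowerSeries (PowerSeries 𝒪))),
      PowerSeries.C (PowerSeries.C (PowerSeries.C (((p : ℕ) : 𝒪) ^ a))) * L =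
        F * G + PowerSeries.C (PowerSeries.C (PowerSeries.X - PowerSeries.C (algebraMap ℤ_[p] 𝒪 xlim))) * U :=
  ⟨not_dvd_of_uniform_members 𝒪 hp F L x xlim c hxk hxlim hconv hmem hL,
   c, dvd_limit_of_uniform_members 𝒪 hp F L x xlim c hxk hxlim hconv hmem⟩

end Uniform2

/-! ### Theorem P: the VARYING-constant accumulation lemma itself — no UFD needed either.
Content decomposition of the limit fibres + non-zero-divisor cancellation turn the member identities into EXACT
fibre identities `F'_k · W_k = L'_k` for the unit-content parts, and the solving lemma finishes. -/

section Plain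

open Filter

/-- content decomposition in `𝒪⟦T₂⟧⟦T₁⟧` over a DVR: `A = π^b · A'` with `A'` of unit content. -/
lemma exists_eq_C_C_pow_mul_not_dvd {𝒪 : Type*} [CommRing 𝒪] [IsDomain 𝒪] [IsDiscreteValuationRing 𝒪]
    (π : 𝒪) (hπ : Irreducible π) (A : PowerSeries (PowerSeries 𝒪)) (hA : A ≠ 0) :
    ∃ (b : ℕ) (A' : PowerSeries (PowerSeries 𝒪)),
      A = PowerSeries.C (PowerSeries.C (π ^ b)) * A' ∧ ¬ PowerSeries.C (PowerSeries.C π) ∣ A' := by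
  classical
  obtain ⟨i₀, j₀, hd⟩ : ∃ i j, co i j A ≠ 0 := by
    by_contra hall
    push Not at hall
    exact hA (eq_zero_of_co_eq_zero A hall)
  have hex : ∃ n : ℕ, ∃ i j, ¬ π ^ (n + 1) ∣ co i j A := by
    obtain ⟨N, hN⟩ := finite_pow_dvd_of_dvr π hπ _ hd
    rcases N with _ | n
    · exact absurd (by simp) hN
    · exact ⟨n, i₀, j₀, hN⟩
  let b := Nat.find hex
  obtain ⟨i₁, j₁, hb⟩ : ∃ i j, ¬ π ^ (b + 1) ∣ co i j A := Nat.find_spec hex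
  have hball : ∀ i j, π ^ b ∣ co i j A := by
    intro i j
    rcases Nat.eq_zero_or_pos b with h0 | hpos
    · rw [h0, pow_zero]; exact one_dvd _
    · have hmin := Nat.find_min hex (m := b - 1) (by omega)
      push Not at hmin
      have := hmin i j
      rwa [Nat.sub_add_cancel hpos] at this
  obtain ⟨A', hA'⟩ := (C_C_dvd_iff_forall_co_dvd (π ^ b) A).mpr hball
  refine ⟨b, A', hA', ?_⟩
  intro h
  apply hb
  have h' := (C_C_dvd_iff_forall_co_dvd π A').mp h i₁ j₁
  rw [hA', co_C_C_mul, pow_succ]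
  exact mul_dvd_mul_left _ h'

/-- **Theorem P** (`AccumulationLemma₂` with its quantifiers opened): VARYING member constants `p^{c_k}`,
nondegenerate limit fibre of `F` ⟹ `p^a·L ∈ (F, [X − x_∞])`. -/
theorem dvd_limit_of_members {p : ℕ} [Fact p.Prime]
    (𝒪 : Type*) [CommRing 𝒪] [IsDomain 𝒪] [IsDiscreteValuationRing 𝒪] [Algebra ℤ_[p] 𝒪]
    [IsAdicComplete (IsLocalRing.maximalIdeal 𝒪) 𝒪] (hp : Irreducible ((p : ℕ) : 𝒪))
    (F L : PowerSeries (PowerSeries (PowerSeries 𝒪))) (x : ℕ → ℤ_[p]) (xlim : ℤ_[p]) (c : ℕ → ℕ)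
    (hxk : ∀ k, ‖x k‖ < 1) (hxlim : ‖xlim‖ < 1)
    (hconv : Tendsto x atTop (nhds xlim))
    (hmem : ∀ k, ∃ G U : PowerSeries (PowerSeries (PowerSeries 𝒪)),
      PowerSeries.C (PowerSeries.C (PowerSeries.C (((p : ℕ) : 𝒪) ^ c k))) * L =
        F * G + PowerSeries.C (PowerSeries.C (PowerSeries.X - PowerSeries.C (algebraMap ℤ_[p] 𝒪 (x k)))) * U)
    (hF : ¬ (PowerSeries.C (PowerSeries.C (PowerSeries.X - PowerSeries.C (algebraMap ℤ_[p] 𝒪 xlim))) ∣ F)) :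
    ∃ (a : ℕ) (G U : PowerSeries (PowerSeries (PowerSeries 𝒪))),
      PowerSeries.C (PowerSeries.C (PowerSeries.C (((p : ℕ) : 𝒪) ^ a))) * L =
        F * G + PowerSeries.C (PowerSeries.C (PowerSeries.X - PowerSeries.C (algebraMap ℤ_[p] 𝒪 xlim))) * U := by
  classical
  have hprime : Prime ((p : ℕ) : 𝒪) := hp.prime
  have hpmem : ((p : ℕ) : 𝒪) ∈ IsLocalRing.maximalIdeal 𝒪 :=
    (IsLocalRing.mem_maximalIdeal _).mpr hp.not_isUnit
  have hpt : ∀ z : ℤ_[p], ‖z‖ < 1 → algebraMap ℤ_[p] 𝒪 z ∈ IsLocalRing.maximalIdeal 𝒪 := by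
    intro z hz
    obtain ⟨y, hy⟩ := (PadicInt.norm_lt_one_iff_dvd z).mp hz
    rw [hy, map_mul, map_natCast]
    exact Ideal.mul_mem_right _ _ hpmem
  set xs : ℕ → 𝒪 := fun k => algebraMap ℤ_[p] 𝒪 (x k) with hxs
  set xsl : 𝒪 := algebraMap ℤ_[p] 𝒪 xlim with hxsl
  have hxs_mem : ∀ k, xs k ∈ IsLocalRing.maximalIdeal 𝒪 := fun k => hpt _ (hxk k)
  have hxsl_mem : xsl ∈ IsLocalRing.maximalIdeal 𝒪 := hpt _ hxlim
  have hdiff : ∀ m : ℕ, ∀ᶠ k in atTop, ((p : ℕ) : 𝒪) ^ m ∣ xs k - xsl := by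
    intro m
    filter_upwards [eventually_pow_dvd_sub x xlim hconv m] with k hk
    have := map_dvd (algebraMap ℤ_[p] 𝒪) hk
    simpa [map_pow, map_natCast, map_sub] using this
  set Finf := EvAt xsl hxsl_mem F with hFinf
  set Linf := EvAt xsl hxsl_mem L with hLinf
  have hfib : ∀ (m k : ℕ), ((p : ℕ) : 𝒪) ^ m ∣ xs k - xsl →
      ∀ H : PowerSeries (PowerSeries (PowerSeries 𝒪)),
        PowerSeries.C (PowerSeries.C (((p : ℕ) : 𝒪) ^ m)) ∣
          EvAt (xs k) (hxs_mem k) H - EvAt xsl hxsl_mem H := by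
    intro m k hk H
    rw [C_C_dvd_iff_forall_co_dvd]
    intro i j
    rw [co, map_sub, map_sub, ← co, ← co, co_EvAt, co_EvAt]
    exact hk.trans (sub_dvd_evAt_sub_evAt _ _ (hxs_mem k) hxsl_mem _)
  have hCne : ∀ m : ℕ, (PowerSeries.C (PowerSeries.C (((p : ℕ) : 𝒪) ^ m)) : PowerSeries (PowerSeries 𝒪)) ≠ 0 := by
    intro m h0
    have := congrArg (fun G => co 0 0 G) h0
    simp only [co, PowerSeries.coeff_zero_eq_constantCoeff_apply, PowerSeries.constantCoeff_C,
      map_zero] at this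
    exact pow_ne_zero _ hp.ne_zero this
  -- the fibre identities
  have hfibre : ∀ k, ∃ Q : PowerSeries (PowerSeries 𝒪),
      PowerSeries.C (PowerSeries.C (((p : ℕ) : 𝒪) ^ c k)) * EvAt (xs k) (hxs_mem k) L =
        EvAt (xs k) (hxs_mem k) F * Q := by
    intro k
    obtain ⟨G, U, hGU⟩ := hmem k
    have e1 : EvAt (xs k) (hxs_mem k) (PowerSeries.C (PowerSeries.C (PowerSeries.C (((p : ℕ) : 𝒪) ^ c k)))) =
        PowerSeries.C (PowerSeries.C (((p : ℕ) : 𝒪) ^ c k)) := by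
      rw [EvAt_C_C, evAt_C]
    have e3 : EvAt (xs k) (hxs_mem k)
        (PowerSeries.C (PowerSeries.C (PowerSeries.X - PowerSeries.C (algebraMap ℤ_[p] 𝒪 (x k))))) = 0 := by
      rw [EvAt_C_C, map_sub, evAt_X, evAt_C,
        show xs k - algebraMap ℤ_[p] 𝒪 (x k) = 0 from sub_self _, map_zero, map_zero]
    have hEv := congrArg (EvAt (xs k) (hxs_mem k)) hGU
    simp only [map_mul, map_add, e1, e3, zero_mul, add_zero] at hEv
    exact ⟨_, hEv⟩
  choose Q hQ using hfibre
  -- case L(x_∞) = 0 : trivial conclusion with a = 0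
  by_cases hL0 : Linf = 0
  · obtain ⟨U, hU⟩ := C_C_dvd_of_EvAt_eq_zero xsl hxsl_mem L hL0
    exact ⟨0, 0, U, by rw [pow_zero, map_one, map_one, map_one, one_mul, mul_zero, zero_add]; exact hU⟩
  -- F(x_∞) ≠ 0 by nondegeneracy
  have hF0 : Finf ≠ 0 := fun h0 => hF (C_C_dvd_of_EvAt_eq_zero xsl hxsl_mem F h0)
  -- content decompositions of the two limit fibres
  obtain ⟨b, F', hF', hF'nd⟩ := exists_eq_C_C_pow_mul_not_dvd ((p : ℕ) : 𝒪) hp Finf hF0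
  obtain ⟨e, L', hL', hL'nd⟩ := exists_eq_C_C_pow_mul_not_dvd ((p : ℕ) : 𝒪) hp Linf hL0
  -- solvability of F'·Z ≡ L' modulo every p^j
  have hsol : ∀ j : ℕ, ∃ Z : PowerSeries (PowerSeries 𝒪),
      PowerSeries.C (PowerSeries.C (((p : ℕ) : 𝒪) ^ j)) ∣ F' * Z - L' := by
    intro j
    set n := j + b + e + 1 with hn
    obtain ⟨k, hk⟩ := (hdiff n).exists
    -- F_k = p^b · F'_k with F'_k ≡ F' (mod p^(j+e+1)), unit content
    obtain ⟨D₁, hD₁⟩ := hfib n k hk F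
    obtain ⟨D₂, hD₂⟩ := hfib n k hk L
    set F'k := F' + PowerSeries.C (PowerSeries.C (((p : ℕ) : 𝒪) ^ (j + e + 1))) * D₁ with hF'k
    set L'k := L' + PowerSeries.C (PowerSeries.C (((p : ℕ) : 𝒪) ^ (j + b + 1))) * D₂ with hL'k
    have hFk : EvAt (xs k) (hxs_mem k) F = PowerSeries.C (PowerSeries.C (((p : ℕ) : 𝒪) ^ b)) * F'k := by
      have : EvAt (xs k) (hxs_mem k) F = Finf + PowerSeries.C (PowerSeries.C (((p : ℕ) : 𝒪) ^ n)) * D₁ := by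
        rw [← hD₁]; ring
      rw [this, hF', hF'k, hn, show j + b + e + 1 = b + (j + e + 1) by ring, pow_add, map_mul, map_mul]
      ring
    have hLk : EvAt (xs k) (hxs_mem k) L = PowerSeries.C (PowerSeries.C (((p : ℕ) : 𝒪) ^ e)) * L'k := by
      have : EvAt (xs k) (hxs_mem k) L = Linf + PowerSeries.C (PowerSeries.C (((p : ℕ) : 𝒪) ^ n)) * D₂ := by
        rw [← hD₂]; ring
      rw [this, hL', hL'k, hn, show j + b + e + 1 = e + (j + b + 1) by ring, pow_add, map_mul, map_mul]
      ring
    have hF'knd : ¬ PowerSeries.C (PowerSeries.C ((p : ℕ) : 𝒪)) ∣ F'k := by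
      intro h
      apply hF'nd
      have h2 : PowerSeries.C (PowerSeries.C ((p : ℕ) : 𝒪)) ∣
          PowerSeries.C (PowerSeries.C (((p : ℕ) : 𝒪) ^ (j + e + 1))) * D₁ := by
        refine dvd_mul_of_dvd_left ?_ _
        rw [C_C_pow]; exact dvd_pow_self _ (by omega)
      have := dvd_sub h h2
      rwa [hF'k, add_sub_cancel_right] at this
    -- member identity at k : p^(c k + e) · L'k = p^b · F'k · Q k
    have hid : PowerSeries.C (PowerSeries.C (((p : ℕ) : 𝒪) ^ (c k + e))) * L'k =
        F'k * (PowerSeries.C (PowerSeries.C (((p : ℕ) : 𝒪) ^ b)) * Q k) := by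
      have := hQ k
      rw [hLk, hFk] at this
      rw [pow_add, map_mul, map_mul]
      calc PowerSeries.C (PowerSeries.C (((p : ℕ) : 𝒪) ^ c k)) * PowerSeries.C (PowerSeries.C (((p : ℕ) : 𝒪) ^ e)) * L'k
          = PowerSeries.C (PowerSeries.C (((p : ℕ) : 𝒪) ^ c k)) * (PowerSeries.C (PowerSeries.C (((p : ℕ) : 𝒪) ^ e)) * L'k) := by ring
        _ = PowerSeries.C (PowerSeries.C (((p : ℕ) : 𝒪) ^ b)) * F'k * Q k := this
        _ = F'k * (PowerSeries.C (PowerSeries.C (((p : ℕ) : 𝒪) ^ b)) * Q k) := by ring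
    -- cancel: p^(c k + e) ∣ p^b · Q k since F'k is a non-zero-divisor mod p-powers
    have hdvd : PowerSeries.C (PowerSeries.C (((p : ℕ) : 𝒪) ^ (c k + e))) ∣
        PowerSeries.C (PowerSeries.C (((p : ℕ) : 𝒪) ^ b)) * Q k :=
      C_C_pow_dvd_of_dvd_mul ((p : ℕ) : 𝒪) hprime F'k hF'knd (c k + e) _ ⟨L'k, hid.symm⟩
    obtain ⟨W, hW⟩ := hdvd
    have hexact : F'k * W = L'k := by
      apply mul_left_cancel₀ (hCne (c k + e))
      rw [hid, hW]; ring
    refine ⟨W, ?_⟩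
    have key : F' * W - L' = -(PowerSeries.C (PowerSeries.C (((p : ℕ) : 𝒪) ^ (j + e + 1))) * D₁ * W) +
        PowerSeries.C (PowerSeries.C (((p : ℕ) : 𝒪) ^ (j + b + 1))) * D₂ := by
      have hF'eq : F' = F'k - PowerSeries.C (PowerSeries.C (((p : ℕ) : 𝒪) ^ (j + e + 1))) * D₁ := by
        rw [hF'k]; ring
      have hL'eq : L' = L'k - PowerSeries.C (PowerSeries.C (((p : ℕ) : 𝒪) ^ (j + b + 1))) * D₂ := by
        rw [hL'k]; ring
      rw [hF'eq, hL'eq, ← hexact]; ring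
    rw [key]
    refine dvd_add (dvd_neg.mpr (dvd_mul_of_dvd_left (dvd_mul_of_dvd_left ?_ _) _)) (dvd_mul_of_dvd_left ?_ _)
    · rw [C_C_pow, C_C_pow]; exact pow_dvd_pow _ (by omega)
    · rw [C_C_pow, C_C_pow]; exact pow_dvd_pow _ (by omega)
  obtain ⟨Z, hZ⟩ := exists_mul_eq_of_forall_exists_mod ((p : ℕ) : 𝒪) hp F' L' hsol
  -- F(x_∞) · (p^e Z) = p^b · L(x_∞)
  have hZ' : Finf * (PowerSeries.C (PowerSeries.C (((p : ℕ) : 𝒪) ^ e)) * Z) =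
      PowerSeries.C (PowerSeries.C (((p : ℕ) : 𝒪) ^ b)) * Linf := by
    rw [hF', hL', mul_assoc, ← mul_assoc F', mul_comm F', mul_assoc, hZ]
  set G := PowerSeries.map (PowerSeries.map (PowerSeries.C (R := 𝒪)))
    (PowerSeries.C (PowerSeries.C (((p : ℕ) : 𝒪) ^ e)) * Z) with hG
  have hEvG : EvAt xsl hxsl_mem G = PowerSeries.C (PowerSeries.C (((p : ℕ) : 𝒪) ^ e)) * Z :=
    EvAt_lift xsl hxsl_mem _
  have hrem : EvAt xsl hxsl_mem
      (PowerSeries.C (PowerSeries.C (PowerSeries.C (((p : ℕ) : 𝒪) ^ b))) * L - F * G) = 0 := by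
    rw [map_sub, map_mul, map_mul, EvAt_C_C, evAt_C, hEvG, ← hFinf, ← hLinf, hZ', sub_self]
  obtain ⟨U, hU⟩ := C_C_dvd_of_EvAt_eq_zero xsl hxsl_mem _ hrem
  exact ⟨b, G, U, by rw [← hU]; ring⟩

end Plain

end Summit.BirchSwinnertonDyer.BirchSwinnertonDyer.Theorems.AccumHelpers

end
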